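import Summits.BirchSwinnertonDyer.Rank1Residual.X12.O11.RouteUBiprimeMember
import HarnessLib

/-!
# ROUTE U, bi-prime members of 𝒞₇: `49a1^{(−q₁q₂)}` with `(−7/q₁) = (−7/q₂) = 1` lies in 𝒞₇, hence
# FULL BSD (Miller's `BSD(E,p)` at every prime) from the bi-prime class theorem

bsd-cm cell (run/shared/lean/pub/bsd-cm/), ROUTE U, seat `bsd-cm-ram` (g5). Verbatim generalisation of
`RouteUPrimeMember` §2 (`classCSeven_of_twist_cm7_prime`, `forall_bsdp_of_twist_cm7_prime`) from a prime
`q` to `m = q₁q₂`: when BOTH prime factors split in `ℚ(√−7)` (`qᵢ ≡ 1, 2, 4 (mod 7)`), every globally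
minimal model of `49a1^{(−q₁q₂)}` with `r_an = 1` is in the class 𝒞₇ (`X12.ClassCSeven`: CM by `ℚ(√−7)`,
good ORDINARY at `2` by the trace form mod `7` + Hasse, bad primes `≠ 7` split in the CM field), so the
bi-prime class theorem `bsdp_seven_of_twist_cm7_biprime` (BSD₇) and the 𝒞₇ assembly
`ClassCSeven.forall_bsdp_iff_bsdp_seven` (LLT24 / Kob13 / LTYZ25 / BF24 / modularity BY NAME) give
FULL BSD. Members of this shape with `|D| ≤ 1500` (all unit-case by the cell's census, kit j237665):
`D = −407, −583, −667, −851, −1199, −1219, −1247` — their certificates (levels `7·|D|·r ≥ 236467`) are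
not filed here. THEOREMS ONLY; no definitions, no named facts; nothing booked.
References: [Miller2011LMS] Def. 1.1; [KrizLi2019] Thm 1.20; [SilvermanAEC2009] V.1.1 (Hasse).
-/

noncomputable section

open scoped Classical
open NumberField WeierstrassCurve DirichletCharacter
open Literature.NumberTheory.EllipticCurves Literature.NumberTheory.EllipticCurves.Rank1Residual
open Literature.NumberTheory.EllipticCurves.KrizLi2019 Literature.NumberTheory.LFunctions
open Literature.NumberTheory.EllipticCurves.ModularForms
open Literature.NumberTheory.QuadraticFields

namespace Summit.BirchSwinnertonDyer.Rank1Residual.X12.O11.RouteU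

/-- **The bi-prime members with `(−7/q₁) = (−7/q₂) = 1` lie in 𝒞₇.** For distinct primes `q₁, q₂ ≠ 7`
with `q₁q₂ ≡ 3 (mod 4)` and `−7` a square mod `q₁` and mod `q₂` (both split in `ℚ(√−7)`), every
globally minimal model `W` of `49a1^{(−q₁q₂)}` with `r_an(W) = 1` satisfies `ClassCSeven W`: CM by
`ℚ(√−7)`, good reduction at `2` (`2 ∤ 7q₁q₂`), ORDINARY at `2` (`a₂ ≡ ±(2² + 2⁵) ≡ ±1 (mod 7)` by the
trace form and `|a₂| ≤ 2` by Hasse, so `a₂` is odd), and the only bad primes `≠ 7` are `q₁`, `q₂`,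
split in `ℚ(√−7)`. [cite: Miller2011LMS, §1 and Def. 1.1] [cite: SilvermanAEC2009, Thm. V.1.1 (Hasse)] -/
theorem classCSeven_of_twist_cm7_biprime {q₁ q₂ : ℕ} [hq₁ : Fact q₁.Prime] [hq₂ : Fact q₂.Prime]
    (hq12 : q₁ ≠ q₂) (hm4 : (q₁ * q₂) % 4 = 3) (hq₁7 : q₁ ≠ 7) (hq₂7 : q₂ ≠ 7)
    (hsq₁ : legendreSym q₁ (-7) = 1) (hsq₂ : legendreSym q₂ (-7) = 1)
    (W : WeierstrassCurve ℚ) [W.IsElliptic] [W.IsGloballyMinimal]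
    (hW : ∃ C : VariableChange ℚ, C • W = cm7.quadraticTwist ((-((q₁ * q₂ : ℕ) : ℤ) : ℤ) : ℚ))
    (hr1 : W.analyticRank = 1) : ClassCSeven W := by
  have hq₁2 : q₁ ≠ 2 := by rintro rfl; omega
  have hq₂2 : q₂ ≠ 2 := by rintro rfl; omega
  have hq12' : q₁.Coprime q₂ := (Nat.coprime_primes hq₁.out hq₂.out).mpr hq12
  have hm0 : (-((q₁ * q₂ : ℕ) : ℤ)) ≠ 0 := by
    have : 0 < q₁ * q₂ := Nat.pos_of_ne_zero (NeZero.ne _)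
    omega
  have hCM : W.HasCM := hasCM_of_twist_cm7 W hm0 hW
  have hKj : cmFieldDiscrOfJ W.j = -7 := cmFieldDiscrOfJ_of_twist_cm7 W hm0 hW
  have hD4 : (-((q₁ * q₂ : ℕ) : ℤ)) % 4 = 1 := by
    have : (((q₁ * q₂ : ℕ) : ℤ) % 4) = 3 := by exact_mod_cast hm4
    omega
  -- a prime `ℓ ∤ q₁q₂` does not divide `−q₁q₂`
  have hqd : ∀ {ℓ : ℕ}, ℓ.Prime → ℓ ≠ q₁ → ℓ ≠ q₂ → ¬ ((ℓ : ℤ) ∣ -((q₁ * q₂ : ℕ) : ℤ)) :=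
    fun {ℓ} hℓ h₁ h₂ h => by
      rw [dvd_neg] at h
      have h' : ℓ ∣ q₁ * q₂ := by exact_mod_cast h
      rcases (Nat.Prime.dvd_mul hℓ).mp h' with h | h
      · exact h₁ ((Nat.prime_dvd_prime_iff_eq hℓ hq₁.out).mp h)
      · exact h₂ ((Nat.prime_dvd_prime_iff_eq hℓ hq₂.out).mp h)
  -- good reduction at `2`
  have hgood2 : W.HasGoodReductionAtPrime 2 :=
    hasGoodReductionAtPrime_of_twist_cm7 W hD4 hW 2 (by norm_num) (hqd Nat.prime_two (Ne.symm hq₁2) (Ne.symm hq₂2))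
  -- ordinary at `2`: `a₂ ≡ ±1 (mod 7)` and `a₂² ≤ 8`
  have hsqf : Squarefree (-((q₁ * q₂ : ℕ) : ℤ)) := by
    rw [← Int.squarefree_natAbs, Int.natAbs_neg, Int.natAbs_natCast]
    exact (Nat.squarefree_mul hq12').mpr ⟨hq₁.out.squarefree, hq₂.out.squarefree⟩
  have h7D : ¬ ((7 : ℤ) ∣ -((q₁ * q₂ : ℕ) : ℤ)) := hqd (by norm_num) (Ne.symm hq₁7) (Ne.symm hq₂7)
  have ha := lFunction_twist_cm7_mod_seven W hD4 hsqf h7D hW 2 (by norm_num)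
  rw [W.LFunction_apply_prime_eq_frobeniusTrace 2 hgood2,
    show (-((q₁ * q₂ : ℕ) : ℤ)).natAbs = q₁ * q₂ by rw [Int.natAbs_neg, Int.natAbs_natCast]] at ha
  have hH := W.frobeniusTrace_sq_le_four_mul 2 hgood2
  norm_num at hH
  have hgcd : ((2 : ℕ) : ℤ).gcd ((q₁ * q₂ : ℕ) : ℤ) = 1 := by
    rw [Int.gcd_natCast_natCast, ← Nat.coprime_iff_gcd_eq_one]
    exact Nat.Coprime.mul_right ((Nat.coprime_primes Nat.prime_two hq₁.out).mpr (Ne.symm hq₁2))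
      ((Nat.coprime_primes Nat.prime_two hq₂.out).mpr (Ne.symm hq₂2))
  have hodd : ¬ (2 : ℤ) ∣ W.frobeniusTrace 2 := by
    have key : (W.frobeniusTrace 2 : ZMod 7) = 1 ∨ (W.frobeniusTrace 2 : ZMod 7) = -1 := by
      rcases jacobiSym.eq_one_or_neg_one hgcd with hJ | hJ <;> rw [hJ] at ha
      · left; rw [ha]; decide
      · right; rw [ha]; decide
    generalize W.frobeniusTrace 2 = a at hH key
    have hb1 : -2 ≤ a := by nlinarith
    have hb2 : a ≤ 2 := by nlinarith
    interval_cases a <;> first | decide | exact absurd key (by decide)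
  refine ⟨hCM, hKj, hr1, ⟨hgood2, hodd⟩, fun ℓ hℓ hℓ7 hbad => ?_⟩
  -- the bad primes `≠ 7` are `q₁`, `q₂`, split in `ℚ(√−7)`
  have hdvd : (ℓ : ℤ) ∣ -((q₁ * q₂ : ℕ) : ℤ) :=
    dvd_of_not_hasGoodReductionAtPrime_twist_cm7 W hD4 hW ℓ hℓ7 hbad
  rw [dvd_neg] at hdvd
  have hdvd' : ℓ ∣ q₁ * q₂ := by exact_mod_cast hdvd
  have hℓ2 : ℓ ≠ 2 := by
    rintro rfl
    rcases (Nat.Prime.dvd_mul Nat.prime_two).mp hdvd' with h | h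
    · exact hq₁2 ((Nat.prime_dvd_prime_iff_eq Nat.prime_two hq₁.out).mp h).symm
    · exact hq₂2 ((Nat.prime_dvd_prime_iff_eq Nat.prime_two hq₂.out).mp h).symm
  have hsqℓ : legendreSym ℓ (-7) = 1 := by
    rcases (Nat.Prime.dvd_mul hℓ.out).mp hdvd' with h | h
    · have := (Nat.prime_dvd_prime_iff_eq hℓ.out hq₁.out).mp h; subst this; convert hsq₁
    · have := (Nat.prime_dvd_prime_iff_eq hℓ.out hq₂.out).mp h; subst this; convert hsq₂
  refine ⟨?_, ?_⟩
  · rw [hKj, dvd_neg]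
    intro h
    exact hℓ7 ((Nat.prime_dvd_prime_iff_eq hℓ.out (by norm_num)).mp (by exact_mod_cast h))
  · rw [if_neg hℓ2, hKj]
    have h0 : ((-7 : ℤ) : ZMod ℓ) ≠ 0 := by
      intro h
      rw [ZMod.intCast_zmod_eq_zero_iff_dvd] at h
      rw [Int.natCast_dvd, show (-7 : ℤ).natAbs = 7 by rfl] at h
      exact hℓ7 ((Nat.prime_dvd_prime_iff_eq hℓ.out (by norm_num)).mp h)
    exact (legendreSym.eq_one_iff ℓ h0).mp hsqℓ

/-- **ROUTE U ⇒ FULL BSD for the bi-prime members of 𝒞₇.** With the inputs of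
`bsdp_seven_of_twist_cm7_biprime` and `(−7/q₁) = (−7/q₂) = 1` (so that `W ∈ 𝒞₇` by
`classCSeven_of_twist_cm7_biprime`), Miller's `BSD(E,p)` holds at EVERY prime `p`: at `p = 7` by the
bi-prime class theorem, at `p ≠ 7` by the 𝒞₇ assembly `ClassCSeven.forall_bsdp_iff_bsdp_seven` from the
named facts Li–Liu–Tian 2024 Thm 1.1 (i), Kobayashi 2013 Cor. 1.4, Li–Tian–Yan–Zhu 2025 Thm 1.1 (ii),
Burungale–Flach 2024 and modularity. [cite: Miller2011LMS, §1 and Def. 1.1 (arXiv:1010.2431 p. 3)]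
[cite: KrizLi2019, Thm. 1.20 and Rem. 3.10] -/
theorem forall_bsdp_of_twist_cm7_biprime {q₁ q₂ r : ℕ} [hq₁ : Fact q₁.Prime] [hq₂ : Fact q₂.Prime]
    [hr : Fact r.Prime]
    (hq12 : q₁ ≠ q₂) (hm4 : (q₁ * q₂) % 4 = 3) (hr4 : r % 4 = 3) (hq₁7 : q₁ ≠ 7) (hq₂7 : q₂ ≠ 7)
    (hr7 : r ≠ 7) (hr3 : r ≠ 3) (hrq₁ : r ≠ q₁) (hrq₂ : r ≠ q₂)
    (h7split : legendreSym 7 (-(r : ℤ)) = 1) (hsplit₁ : legendreSym q₁ (-(r : ℤ)) = 1)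
    (hsplit₂ : legendreSym q₂ (-(r : ℤ)) = 1)
    (hsq₁ : legendreSym q₁ (-7) = 1) (hsq₂ : legendreSym q₂ (-7) = 1)
    (hcert₁ : ∀ (ω : DirichletCharacter ℚ_[7] 7), IsTeichmullerCharacter ω →
      ∀ θ : DirichletCharacter ℚ_[7] (7 * (q₁ * q₂)),
        (∀ j : ZMod (7 * (q₁ * q₂)), θ j =
          (jacobiSym (j.val : ℤ) (q₁ * q₂) : ℚ_[7]) * ω (j.val : ZMod 7) ^ 4) →
        ‖generalizedBernoulli 1 θ‖ = 1)
    (hcert₂ : ∀ (ω : DirichletCharacter ℚ_[7] 7), IsTeichmullerCharacter ω →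
      ∀ θ : DirichletCharacter ℚ_[7] (7 * (q₁ * q₂) * r),
        (∀ j : ZMod (7 * (q₁ * q₂) * r), θ j =
          ((jacobiSym (j.val : ℤ) (q₁ * q₂) * jacobiSym (j.val : ℤ) r : ℤ) : ℚ_[7]) *
            ω (j.val : ZMod 7) ^ 1) →
        ‖generalizedBernoulli 1 θ‖ = 1)
    (hKL : KrizLi2019.thm120_padicLogHeegner_unit_of_bernoulli)
    (hRem : KrizLi2019.rem310_padicLogHeegner_integral)
    (W : WeierstrassCurve ℚ) [W.IsElliptic] [W.IsGloballyMinimal] [NeZero (W.conductorNorm ℤ)]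
    (hW : ∃ C : VariableChange ℚ, C • W = cm7.quadraticTwist ((-((q₁ * q₂ : ℕ) : ℤ) : ℤ) : ℚ))
    (K : Type) [Field K] [NumberField K] [NeZero (NumberField.discr K).natAbs]
    (hK : IsImaginaryQuadratic K) (hdK : NumberField.discr K = -(r : ℤ))
    (D : ModularParametrizationData W (W.conductorNorm ℤ))
    (H : HeegnerDatum (W.conductorNorm ℤ) (NumberField.discr K)) (ι : K →+* ℂ) (ιp : K →+* ℚ_[7])
    (P : (W.baseChange K).toAffine.Point)
    (hGZ : gross_zagier (W.conductorNorm ℤ) W K) (hKo : kolyvagin (W.conductorNorm ℤ) W K)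
    (hGZK : rank_eq_analyticRank_of_analyticRank_le_one) (hmod : hasEntireLFunction_rat)
    (hP : WeierstrassCurve.Affine.Point.map ι.toRatAlgHom P = heegnerPointComplex D H)
    (hr1 : W.analyticRank = 1)
    (hLt : (W.quadraticTwist (NumberField.discr K : ℚ)).entireLFunction 1 ≠ 0)
    (Wd : WeierstrassCurve ℚ) [Wd.IsElliptic] [Wd.IsGloballyMinimal] (Cd : VariableChange ℚ)
    (hWd : Cd • W.quadraticTwist (NumberField.discr K : ℚ) = Wd)
    (hBF : bsdTriple_of_hasCM_of_L_one_ne_zero)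
    (hu : padicValRat 7 (Cd.u : ℚ) = 0)
    (hC : Rubin1983.thmC_seven_quadraticField)
    (hBG : BuhlerGross1985.firstDescent_seven_oddTwist_of_bernoulli)
    [Finite (AddCommGroup.torsion (W.baseChange K).toAffine.Point)]
    (crd : (W.baseChange K).toAffine.Point →+ ℤ) (g : (W.baseChange K).toAffine.Point)
    (hg : crd g = 1) (hker : ∀ x, crd x = 0 → IsOfFinAddOrder x)
    (hc7 : ¬ ((7 : ℤ) ∣ D.c)) (hLLT : LiLiuTian2024.thm11_bsdp_of_cm_rank_one)
    (hKob : Kobayashi2013.cor14_bsdp_of_cm_rank_one) (hLTYZ : LiTianYanZhu2025.thm11_bsdp_of_cm_rank_one) :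
    ∀ p : ℕ, p.Prime → BSDp W p :=
  (ClassCSeven.forall_bsdp_iff_bsdp_seven hBF hmod hLLT hKob hLTYZ
      (classCSeven_of_twist_cm7_biprime hq12 hm4 hq₁7 hq₂7 hsq₁ hsq₂ W hW hr1)).2
    (bsdp_seven_of_twist_cm7_biprime hq12 hm4 hr4 hq₁7 hq₂7 hr7 hr3 hrq₁ hrq₂ h7split hsplit₁ hsplit₂
      hcert₁ hcert₂ hKL hRem W hW K hK hdK D H ι ιp P hGZ hKo hGZK hmod hP hr1 hLt Wd Cd hWd hBF hu hC
      hBG crd g hg hker hc7)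

end Summit.BirchSwinnertonDyer.Rank1Residual.X12.O11.RouteU

end
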